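/-
Literature/NumberTheory/ComplexMultiplication/DegenerateCMTypesAbelianKernelsExponentFourOdd.lean — pub-hodgecm2 (COR-CM), KEPT Literature
lane lit-deligne-3 gen 66, file F66g.  THEOREMS ONLY (no `def`, no named fact, no `sorry`, no instance, no notation; D-0026 net debt 0).
HC_CM is NOT proved.
-/
import Literature.NumberTheory.ComplexMultiplication.DegenerateCMTypesAbelianKernelsExponentTwiceOdd
import Literature.NumberTheory.ComplexMultiplication.DegenerateCMTypesAbelianKernelsIndexFourPrimePowers
import Literature.NumberTheory.ComplexMultiplication.DegenerateCMTypesAbelianKernelsIndexFour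
import HarnessLib

/-!
# The rank of a CM type by kernels in EXPONENT `4m`, `m` ODD ARBITRARY (any finite abelian group):
# `rank + #B₂ + 2·#B₄ + Σ_{d ∣ m, d ≠ 1} (φ(2d)·#B_{2,d} + φ(4d)·#B_{4,d}) = |G|/2 + 1`, every index class decided

Topic `Literature/NumberTheory/ComplexMultiplication` (namespace `Literature.NumberTheory.ComplexMultiplication.CyclicCMType.AbelianKernels`); cell
`pub-hodgecm2` (COR-CM), KEPT Literature lane `lit-deligne-3` gen 66, file F66g — the GROUP-LEVEL synthesis of the lane's ARBITRARY-ODD-PART programme for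
`2`-part of exponent `4`: Kubota's defect regrouped by kernels, the index classes `2d` and `4d` indexed by the DIVISORS `d` of `m`, decided by Dodson (index
`2`), Yanai (index `4`), the lane's F66c (index `2d`, `d ≠ 1`) and F66d (index `4d`, `d ≠ 1`); cyclicity of the quotient is a clause of every class but
index `2`.  The squarefree case is the lane's F65h, the exponent-`2m` sibling F66e.  KERNEL ONLY: theorems; no `def`, no named fact, no instance, no notation
(D-0014 ∕ D-0026 net debt `0`).  HC_CM is NOT proved here or anywhere in the lane.

## Mathematics

Kubota's count [Kubota1965, §4 Lemma 2] regrouped by kernels (White; tree `typeRank_add_sum_totient_eq`): `rank(T) + Σ_H φ([G:H]) = |G|/2 + 1` over the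
admissible kernels `H ∌ ρ`, `G/H` cyclic, whose characters vanish on `T`.  If `g^{4m} = 1` on `G` (`m` odd) an admissible kernel has index `2d` (`4 ∤ [G:H]`,
`d = [G:H]/2`) or `4d` (`4 ∣ [G:H]`, `d = [G:H]/4`) with `d ∣ m` (**`index_div_dvd_of_exponent_four_mul`**).  The classes are DECIDED: index `2` by even
splitting ([Dodson1984] §3.1.1), index `4` (cyclic quotient) by `2·#(T ∩ gH) = |H|` for all `g` ([Yanai2015IndexDegeneracy]; tree `…iff_of_index_four`),
index `2d` and `4d` (`d ≠ 1`, cyclic quotient) by the vanishing of the mixed differences along the prime torsion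
`Σ_{ε∈{0,1}^{primes(d)}} (−1)^{|ε|} #(T ∩ g·Π_{ε_q=1} x_q·H) = 0` (`x_q^q ∈ H`; F66c, F66d: [Hazama2003CyclicCM] Lemma 4.6.1 mechanism, [LamLeung2000]
Thm. 2.2, [Washington1997] Prop. 2.4).  Hence, EXACTLY (**`typeRank_add_card_kernels_eq_of_exponent_four_mul_odd`**),

  `rank(T) + #B₂ + 2·#B₄ + Σ_{d ∣ m, d ≠ 1} (φ(2d)·#B_{2,d} + φ(4d)·#B_{4,d}) = |G|/2 + 1`

(`φ(4d) = 2φ(2d) = 2φ(d)`), and `T` is NONDEGENERATE iff all four families of sets are empty (**`typeRank_eq_iff_of_exponent_four_mul_odd`**).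

* §0 private helpers (suffix `_eg`) and **`index_div_dvd_of_exponent_four_mul`**.
* §1 **`typeRank_add_card_kernels_eq_of_exponent_four_mul_odd`** (the admissible kernels split by `4 ∣ [G:H]`, each half partitioned by `H ↦ [G:H]/2`
  resp. `[G:H]/4 ∈ divisors(m)`, each fibre identified with `B₂ ∕ B_{2,d}` resp. `B₄ ∕ B_{4,d}`; bookkeeping by `omega`),
  **`typeRank_eq_iff_of_exponent_four_mul_odd`**.

PRESEARCH (lane rule): as for F65h ∕ F66e — not found as printed for general odd `m` (corpus hybrid + galaxy «degenerate CM type | rank of a CM-type | index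
of degeneracy», all stars, lane queries gen 64–66: 0 relevant); the ingredients (Kubota, White, Dodson, Yanai, Hazama, Lam–Leung, Washington) are cited at
each statement; recorded as the lane's own elementary theorem.

HONEST REGISTER.  Unconditional and elementary given the tree.  `2`-part of the exponent `≤ 4`; nothing is claimed about the Hodge classes of degenerate types.
HC_CM is NOT proved and not used.

## References

* [Kubota1965] T. Kubota, *On the field extension by complex multiplication*, Trans. AMS 118 (1965), §4 Lemma 2.
* [White1993SporadicCycles] S. P. White, *Sporadic cycles on CM abelian varieties*, Compositio Math. 88 (1993), §4, proof of Lemma 3 (p. 131).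
* [Dodson1984] B. Dodson, *The structure of Galois groups of CM-fields*, Trans. AMS 283 (1984), §3.1.1 Theorem.
* [Yanai2015IndexDegeneracy] H. Yanai, *On degenerate CM-types*, J. Number Theory 152 (2015), Thm. 4.1 (proof, p. 818).
* [Hazama2003CyclicCM] F. Hazama, *Hodge cycles on abelian varieties with complex multiplication by cyclic CM-fields*, J. Math. Sci. Univ. Tokyo 10
  (2003): Prop. 4.3, Lemma 4.6.1, Thm. 4.8.
* [LamLeung2000] T. Y. Lam, K. H. Leung, *On vanishing sums of roots of unity*, J. Algebra 224 (2000), Thm. 2.2 (via the lane's F66b–F66d).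

## Provenance

Cell `pub-hodgecm2` (COR-CM), KEPT Literature lane `lit-deligne-3` gen 66 (claim ABELIAN-EXPONENT-4ODD-RANK; count-neutral, own lane), file F66g; neighbours
cited by name, nothing restated: `DegenerateCMTypesAbelianKernels` (`typeRank_add_sum_totient_eq`, `…iff_of_index_two`), `DegenerateCMTypesAbelianKernelsIndexFour`
(`…iff_of_index_four`), `DegenerateCMTypesAbelianKernelsExponentTwiceOdd` (F66e, for the cone), `DegenerateCMTypesAbelianKernelsIndexTwicePrimePowers` ∕
`…IndexFourPrimePowers` (F66c ∕ F66d `…_of_index_{two,four}_mul_odd`).  The proof text is the lane's F65h with divisor classes.  Theorems only; net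
Literature debt 0.
-/

noncomputable section

open scoped BigOperators Classical

namespace Literature.NumberTheory.ComplexMultiplication

namespace CyclicCMType

namespace AbelianKernels

variable {G : Type*} [CommGroup G] [Fintype G] [DecidableEq G] {ρ : G} {T : Finset G} {m : ℕ}

/-! ## §0 Helpers: admissible kernels in exponent `4m` -/

section Helpers

omit [Fintype G] [DecidableEq G] in
/-- The index of an admissible kernel divides the exponent `4m` and is even. [folklore] -/
private theorem index_dvd_and_two_dvd_eg (hexp : ∀ g : G, g ^ (4 * m) = 1) {H : Subgroup G} (hρH : ρ ∉ H) (hρ2 : ρ * ρ = 1)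
    (hcyc : IsCyclic (G ⧸ H)) : H.index ∣ 4 * m ∧ 2 ∣ H.index := by
  haveI := hcyc
  refine ⟨?_, ?_⟩
  · rw [Subgroup.index_eq_card, ← IsCyclic.exponent_eq_card]
    exact Monoid.exponent_dvd_of_forall_pow_eq_one fun x => QuotientGroup.induction_on x fun g => by
      rw [← QuotientGroup.mk_pow, hexp, QuotientGroup.mk_one]
  · have hρ1 : (ρ : G ⧸ H) ≠ 1 := fun h => hρH ((QuotientGroup.eq_one_iff ρ).1 h)
    have hord : orderOf (ρ : G ⧸ H) = 2 := by
      haveI : Fact (Nat.Prime 2) := ⟨Nat.prime_two⟩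
      refine orderOf_eq_prime ?_ hρ1
      rw [pow_two, ← QuotientGroup.mk_mul, hρ2, QuotientGroup.mk_one]
    rw [Subgroup.index_eq_card, ← hord]
    exact orderOf_dvd_natCard _

omit [Fintype G] [DecidableEq G] in
/-- `G/H` is cyclic for `H` of index `2`. [folklore] -/
private theorem isCyclic_quotient_of_index_two_eg [Finite G] {H : Subgroup G} (hidx : H.index = 2) : IsCyclic (G ⧸ H) := by
  haveI : Fact (Nat.Prime 2) := ⟨Nat.prime_two⟩
  exact isCyclic_of_prime_card (p := 2) (by rw [← Subgroup.index_eq_card, hidx])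

omit [Fintype G] [DecidableEq G] in
/-- **The admissible kernels in exponent `4m`, `m` odd**: a subgroup `H ∌ ρ` with cyclic quotient in a commutative group killed by `4m` has index `2d`
(`4 ∤ [G:H]`, `d = [G:H]/2`) or `4d` (`4 ∣ [G:H]`, `d = [G:H]/4`) with `d ∣ m`. [cite: Kubota1965, §4 Lemma 2]
[cite: White1993SporadicCycles, §4, proof of Lemma 3 (p. 131)] -/
theorem index_div_dvd_of_exponent_four_mul (hexp : ∀ g : G, g ^ (4 * m) = 1) {H : Subgroup G} (hρH : ρ ∉ H) (hρ2 : ρ * ρ = 1)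
    (hcyc : IsCyclic (G ⧸ H)) :
    (¬ 4 ∣ H.index → H.index / 2 ∣ m ∧ H.index = 2 * (H.index / 2)) ∧ (4 ∣ H.index → H.index / 4 ∣ m ∧ H.index = 4 * (H.index / 4)) := by
  obtain ⟨hdvd, h2⟩ := index_dvd_and_two_dvd_eg hexp hρH hρ2 hcyc
  refine ⟨fun h4 => ?_, fun h4 => ?_⟩
  · have hidx : H.index = 2 * (H.index / 2) := (Nat.mul_div_cancel' h2).symm
    have hd2m : H.index / 2 ∣ 2 * m := by
      apply Nat.dvd_of_mul_dvd_mul_left two_pos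
      rw [← hidx, show 2 * (2 * m) = 4 * m by ring]
      exact hdvd
    have hdodd : Nat.Coprime (H.index / 2) 2 := by
      rw [Nat.coprime_comm, Nat.Prime.coprime_iff_not_dvd Nat.prime_two]
      intro h22
      apply h4
      rw [hidx]
      exact Nat.mul_dvd_mul_left 2 h22 |>.trans (by norm_num)
    exact ⟨hdodd.dvd_of_dvd_mul_left hd2m, hidx⟩
  · have hidx : H.index = 4 * (H.index / 4) := (Nat.mul_div_cancel' h4).symm
    exact ⟨Nat.dvd_of_mul_dvd_mul_left four_pos (hidx ▸ hdvd), hidx⟩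

end Helpers

/-! ## §1 The rank of a CM type in exponent `4m` (`m` odd): Kubota's defect by kernels, every index class decided -/

section ExponentFourOdd

/-- **THE RANK OF A CM TYPE BY KERNELS, EXPONENT `4m` WITH `m` ODD** (any finite commutative group `G` with `g^{4m} = 1`, conjugation `ρ`, CM type `T`):

  `rank(T) + #B₂ + 2·#B₄ + Σ_{d ∣ m, d ≠ 1} (φ(2d)·#B_{2,d} + φ(4d)·#B_{4,d}) = |G|/2 + 1`,

with `B₂` (index `2`, even splitting, Dodson), `B₄` (index `4`, CYCLIC quotient, every coset met in `|H|/2` elements — Yanai's criterion, tree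
`…iff_of_index_four`), `B_{2,d}` (index `2d`, CYCLIC quotient, vanishing mixed differences of the coset counts along the prime torsion — the lane's F66c) and
`B_{4,d}` (index `4d`, CYCLIC quotient, the same condition — the lane's F66d), for the divisors `d ≠ 1` of `m`.  The squarefree case is the lane's F65h.
[cite: Kubota1965, §4 Lemma 2] [cite: White1993SporadicCycles, §4, proof of Lemma 3 (p. 131)] [cite: Hazama2003CyclicCM, Prop. 4.3, Lemma 4.6.1 and Thm. 4.8]
[cite: Dodson1984, §3.1.1 Theorem] [cite: Yanai2015IndexDegeneracy, Thm. 4.1] [cite: LamLeung2000, Thm. 2.2] -/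
theorem typeRank_add_card_kernels_eq_of_exponent_four_mul_odd (hodd : ¬ 2 ∣ m)
    (h : IsCMTypeWith ρ (T : Set G)) (hexp : ∀ g : G, g ^ (4 * m) = 1) :
    typeRank G (T : Set G) +
      ((Finset.univ : Finset (Subgroup G)).filter fun H => ρ ∉ H ∧ H.index = 2 ∧
        (T.filter fun s => s ∈ H).card = (T.filter fun s => s ∉ H).card).card +
      2 * ((Finset.univ : Finset (Subgroup G)).filter fun H : Subgroup G => ρ ∉ H ∧ H.index = 4 ∧ IsCyclic (G ⧸ H) ∧
        ∀ g : G, 2 * ((T.filter fun s => g⁻¹ * s ∈ H).card) = Nat.card H).card +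
      ∑ d ∈ m.divisors.erase 1,
        ((2 * d).totient *
          ((Finset.univ : Finset (Subgroup G)).filter fun H => ρ ∉ H ∧ H.index = 2 * d ∧ IsCyclic (G ⧸ H) ∧
            ∀ (g : G) (x : ↥d.primeFactors → G), (∀ q, x q ^ (q : ℕ) ∈ H) →
              ∑ ε : ↥d.primeFactors → Bool, (∏ q, (if ε q then (-1 : ℤ) else 1)) *
                ((T.filter fun s => (g * ∏ q, (if ε q then x q else 1))⁻¹ * s ∈ H).card : ℤ) = 0).card +
        (4 * d).totient *
          ((Finset.univ : Finset (Subgroup G)).filter fun H => ρ ∉ H ∧ H.index = 4 * d ∧ IsCyclic (G ⧸ H) ∧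
            ∀ (g : G) (x : ↥d.primeFactors → G), (∀ q, x q ^ (q : ℕ) ∈ H) →
              ∑ ε : ↥d.primeFactors → Bool, (∏ q, (if ε q then (-1 : ℤ) else 1)) *
                ((T.filter fun s => (g * ∏ q, (if ε q then x q else 1))⁻¹ * s ∈ H).card : ℤ) = 0).card) =
      Fintype.card G / 2 + 1 := by
  have hρ2 : ρ * ρ = 1 := by simpa [smul_eq_mul] using h.invol (1 : G)
  have key := typeRank_add_sum_totient_eq h
  have hm0 : m ≠ 0 := by
    rintro rfl
    exact hodd (dvd_zero 2)
  set A := (Finset.univ : Finset (Subgroup G)).filter (fun H => ρ ∉ H ∧ IsCyclic (G ⧸ H) ∧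
    ∀ χ : AddChar (Additive G) ℂ, (∀ g : G, χ (Additive.ofMul g) = 1 ↔ g ∈ H) →
      ∑ s ∈ T, χ (Additive.ofMul s) = 0) with hA
  set B₂ := (Finset.univ : Finset (Subgroup G)).filter (fun H => ρ ∉ H ∧ H.index = 2 ∧
    (T.filter fun s => s ∈ H).card = (T.filter fun s => s ∉ H).card) with hB₂
  set B₄ := ((Finset.univ : Finset (Subgroup G)).filter fun H : Subgroup G => ρ ∉ H ∧ H.index = 4 ∧ IsCyclic (G ⧸ H) ∧
    ∀ g : G, 2 * ((T.filter fun s => g⁻¹ * s ∈ H).card) = Nat.card H) with hB₄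
  -- the two class maps
  set cls₂ : Subgroup G → ℕ := fun H => H.index / 2 with hcls₂
  set cls₄ : Subgroup G → ℕ := fun H => H.index / 4 with hcls₄
  -- facts about a divisor `d` of `m`
  have hdodd : ∀ d ∈ m.divisors, ¬ 2 ∣ d := fun d hd h2 => hodd (h2.trans (Nat.dvd_of_mem_divisors hd))
  have hnot4 : ∀ d ∈ m.divisors, ¬ 4 ∣ 2 * d := by
    intro d hd h4
    apply hdodd d hd
    have : 2 * 2 ∣ 2 * d := h4
    exact Nat.dvd_of_mul_dvd_mul_left two_pos this
  have hcls₂d : ∀ (d : ℕ) (H : Subgroup G), H.index = 2 * d → cls₂ H = d := by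
    intro d H hidx
    rw [hcls₂]
    dsimp only
    rw [hidx, Nat.mul_div_cancel_left _ two_pos]
  have hcls₄d : ∀ (d : ℕ) (H : Subgroup G), H.index = 4 * d → cls₄ H = d := by
    intro d H hidx
    rw [hcls₄]
    dsimp only
    rw [hidx, Nat.mul_div_cancel_left _ four_pos]
  -- the two halves of the admissible kernels
  have hmaps₂ : ∀ H ∈ A.filter (fun H => ¬ 4 ∣ H.index), cls₂ H ∈ m.divisors := by
    intro H hH
    rw [Finset.mem_filter, hA, Finset.mem_filter] at hH
    exact Nat.mem_divisors.2 ⟨((index_div_dvd_of_exponent_four_mul hexp hH.1.2.1 hρ2 hH.1.2.2.1).1 hH.2).1, hm0⟩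
  have hmaps₄ : ∀ H ∈ A.filter (fun H => 4 ∣ H.index), cls₄ H ∈ m.divisors := by
    intro H hH
    rw [Finset.mem_filter, hA, Finset.mem_filter] at hH
    exact Nat.mem_divisors.2 ⟨((index_div_dvd_of_exponent_four_mul hexp hH.1.2.1 hρ2 hH.1.2.2.1).2 hH.2).1, hm0⟩
  have hidx₂ : ∀ H ∈ A.filter (fun H => ¬ 4 ∣ H.index), H.index = 2 * cls₂ H := by
    intro H hH
    rw [Finset.mem_filter, hA, Finset.mem_filter] at hH
    exact ((index_div_dvd_of_exponent_four_mul hexp hH.1.2.1 hρ2 hH.1.2.2.1).1 hH.2).2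
  have hidx₄ : ∀ H ∈ A.filter (fun H => 4 ∣ H.index), H.index = 4 * cls₄ H := by
    intro H hH
    rw [Finset.mem_filter, hA, Finset.mem_filter] at hH
    exact ((index_div_dvd_of_exponent_four_mul hexp hH.1.2.1 hρ2 hH.1.2.2.1).2 hH.2).2
  -- §A the fibres of the `2d` half
  have hfib₂0 : (A.filter (fun H => ¬ 4 ∣ H.index)).filter (fun H => cls₂ H = 1) = B₂ := by
    rw [hA, hB₂, Finset.filter_filter, Finset.filter_filter]
    refine Finset.filter_congr fun H _ => ?_
    constructor
    · rintro ⟨⟨hρH, hcyc, hchar⟩, h4, hc⟩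
      have hidx : H.index = 2 := by
        have := ((index_div_dvd_of_exponent_four_mul hexp hρH hρ2 hcyc).1 h4).2
        rw [show H.index / 2 = 1 from hc, mul_one] at this
        exact this
      exact ⟨hρH, hidx, (forall_sum_char_eq_zero_iff_of_index_two hρ2 hρH hidx T).1 hchar⟩
    · rintro ⟨hρH, hidx, hsplit⟩
      have hidx' : H.index = 2 * 1 := by rw [mul_one]; exact hidx
      exact ⟨⟨hρH, isCyclic_quotient_of_index_two_eg hidx, (forall_sum_char_eq_zero_iff_of_index_two hρ2 hρH hidx T).2 hsplit⟩,
        by rw [hidx']; exact hnot4 1 (Nat.one_mem_divisors.2 hm0), hcls₂d 1 H hidx'⟩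
  have hfib₂D : ∀ d ∈ m.divisors, d ≠ 1 →
      (A.filter (fun H => ¬ 4 ∣ H.index)).filter (fun H => cls₂ H = d) =
        (Finset.univ : Finset (Subgroup G)).filter fun H => ρ ∉ H ∧ H.index = 2 * d ∧ IsCyclic (G ⧸ H) ∧
          ∀ (g : G) (x : ↥d.primeFactors → G), (∀ q, x q ^ (q : ℕ) ∈ H) →
            ∑ ε : ↥d.primeFactors → Bool, (∏ q, (if ε q then (-1 : ℤ) else 1)) *
              ((T.filter fun s => (g * ∏ q, (if ε q then x q else 1))⁻¹ * s ∈ H).card : ℤ) = 0 := by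
    intro d hd hd1
    have hd2 : ¬ 2 ∣ d := hdodd d hd
    rw [hA, Finset.filter_filter, Finset.filter_filter]
    refine Finset.filter_congr fun H _ => ?_
    constructor
    · rintro ⟨⟨hρH, hcyc, hchar⟩, h4, hc⟩
      have hidx : H.index = 2 * d := by
        rw [← hc]; exact ((index_div_dvd_of_exponent_four_mul hexp hρH hρ2 hcyc).1 h4).2
      exact ⟨hρH, hidx, hcyc, (forall_sum_char_eq_zero_iff_alternatingSum_of_index_two_mul_odd hd1 hd2 h hρH hcyc hidx).1 hchar⟩
    · rintro ⟨hρH, hidx, hcyc, hcrit⟩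
      exact ⟨⟨hρH, hcyc, (forall_sum_char_eq_zero_iff_alternatingSum_of_index_two_mul_odd hd1 hd2 h hρH hcyc hidx).2 hcrit⟩,
        by rw [hidx]; exact hnot4 d hd, hcls₂d d H hidx⟩
  -- §B the fibres of the `4d` half
  have hfib₄0 : (A.filter (fun H => 4 ∣ H.index)).filter (fun H => cls₄ H = 1) = B₄ := by
    rw [hA, hB₄, Finset.filter_filter, Finset.filter_filter]
    refine Finset.filter_congr fun H _ => ?_
    constructor
    · rintro ⟨⟨hρH, hcyc, hchar⟩, h4, hc⟩
      have hidx : H.index = 4 := by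
        have := ((index_div_dvd_of_exponent_four_mul hexp hρH hρ2 hcyc).2 h4).2
        rw [show H.index / 4 = 1 from hc, mul_one] at this
        exact this
      exact ⟨hρH, hidx, hcyc, (forall_sum_char_eq_zero_iff_of_index_four h hρH hidx hcyc).1 hchar⟩
    · rintro ⟨hρH, hidx, hcyc, hhalf⟩
      have hidx' : H.index = 4 * 1 := by rw [mul_one]; exact hidx
      exact ⟨⟨hρH, hcyc, (forall_sum_char_eq_zero_iff_of_index_four h hρH hidx hcyc).2 hhalf⟩, by rw [hidx], hcls₄d 1 H hidx'⟩
  have hfib₄D : ∀ d ∈ m.divisors, d ≠ 1 →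
      (A.filter (fun H => 4 ∣ H.index)).filter (fun H => cls₄ H = d) =
        (Finset.univ : Finset (Subgroup G)).filter fun H => ρ ∉ H ∧ H.index = 4 * d ∧ IsCyclic (G ⧸ H) ∧
          ∀ (g : G) (x : ↥d.primeFactors → G), (∀ q, x q ^ (q : ℕ) ∈ H) →
            ∑ ε : ↥d.primeFactors → Bool, (∏ q, (if ε q then (-1 : ℤ) else 1)) *
              ((T.filter fun s => (g * ∏ q, (if ε q then x q else 1))⁻¹ * s ∈ H).card : ℤ) = 0 := by
    intro d hd hd1
    have hd2 : ¬ 2 ∣ d := hdodd d hd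
    rw [hA, Finset.filter_filter, Finset.filter_filter]
    refine Finset.filter_congr fun H _ => ?_
    constructor
    · rintro ⟨⟨hρH, hcyc, hchar⟩, h4, hc⟩
      have hidx : H.index = 4 * d := by
        rw [← hc]; exact ((index_div_dvd_of_exponent_four_mul hexp hρH hρ2 hcyc).2 h4).2
      exact ⟨hρH, hidx, hcyc, (forall_sum_char_eq_zero_iff_alternatingSum_of_index_four_mul_odd hd1 hd2 h hρH hcyc hidx).1 hchar⟩
    · rintro ⟨hρH, hidx, hcyc, hcrit⟩
      exact ⟨⟨hρH, hcyc, (forall_sum_char_eq_zero_iff_alternatingSum_of_index_four_mul_odd hd1 hd2 h hρH hcyc hidx).2 hcrit⟩,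
        by rw [hidx]; exact dvd_mul_right 4 _, hcls₄d d H hidx⟩
  -- §C Euler's `φ` summed by classes
  have hsum₂ : ∑ H ∈ A.filter (fun H => ¬ 4 ∣ H.index), H.index.totient =
      ∑ d ∈ m.divisors, (2 * d).totient * ((A.filter (fun H => ¬ 4 ∣ H.index)).filter fun H => cls₂ H = d).card := by
    rw [← Finset.sum_fiberwise_of_maps_to hmaps₂]
    refine Finset.sum_congr rfl fun d _ => ?_
    have hconst : ∀ H ∈ (A.filter (fun H => ¬ 4 ∣ H.index)).filter (fun H => cls₂ H = d), H.index.totient = (2 * d).totient := by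
      intro H hH
      rw [Finset.mem_filter] at hH
      rw [hidx₂ H hH.1, hH.2]
    rw [Finset.sum_congr rfl hconst, Finset.sum_const, smul_eq_mul, mul_comm]
  have hsum₄ : ∑ H ∈ A.filter (fun H => 4 ∣ H.index), H.index.totient =
      ∑ d ∈ m.divisors, (4 * d).totient * ((A.filter (fun H => 4 ∣ H.index)).filter fun H => cls₄ H = d).card := by
    rw [← Finset.sum_fiberwise_of_maps_to hmaps₄]
    refine Finset.sum_congr rfl fun d _ => ?_
    have hconst : ∀ H ∈ (A.filter (fun H => 4 ∣ H.index)).filter (fun H => cls₄ H = d), H.index.totient = (4 * d).totient := by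
      intro H hH
      rw [Finset.mem_filter] at hH
      rw [hidx₄ H hH.1, hH.2]
    rw [Finset.sum_congr rfl hconst, Finset.sum_const, smul_eq_mul, mul_comm]
  have hsplit₂ : ∑ d ∈ m.divisors, (2 * d).totient * ((A.filter (fun H => ¬ 4 ∣ H.index)).filter fun H => cls₂ H = d).card =
      B₂.card + ∑ d ∈ m.divisors.erase 1, (2 * d).totient * ((A.filter (fun H => ¬ 4 ∣ H.index)).filter fun H => cls₂ H = d).card := by
    rw [Finset.sum_eq_add_sum_sdiff_singleton_of_mem (Nat.one_mem_divisors.2 hm0), mul_one, Nat.totient_two, one_mul, hfib₂0,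
      Finset.sdiff_singleton_eq_erase]
  have h4tot : Nat.totient 4 = 2 := by decide
  have hsplit₄ : ∑ d ∈ m.divisors, (4 * d).totient * ((A.filter (fun H => 4 ∣ H.index)).filter fun H => cls₄ H = d).card =
      2 * B₄.card + ∑ d ∈ m.divisors.erase 1, (4 * d).totient * ((A.filter (fun H => 4 ∣ H.index)).filter fun H => cls₄ H = d).card := by
    rw [Finset.sum_eq_add_sum_sdiff_singleton_of_mem (Nat.one_mem_divisors.2 hm0), mul_one, h4tot, hfib₄0, Finset.sdiff_singleton_eq_erase]
  have hsumD : ∑ d ∈ m.divisors.erase 1, (2 * d).totient * ((A.filter (fun H => ¬ 4 ∣ H.index)).filter fun H => cls₂ H = d).card +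
      ∑ d ∈ m.divisors.erase 1, (4 * d).totient * ((A.filter (fun H => 4 ∣ H.index)).filter fun H => cls₄ H = d).card =
      ∑ d ∈ m.divisors.erase 1,
        ((2 * d).totient *
          ((Finset.univ : Finset (Subgroup G)).filter fun H => ρ ∉ H ∧ H.index = 2 * d ∧ IsCyclic (G ⧸ H) ∧
            ∀ (g : G) (x : ↥d.primeFactors → G), (∀ q, x q ^ (q : ℕ) ∈ H) →
              ∑ ε : ↥d.primeFactors → Bool, (∏ q, (if ε q then (-1 : ℤ) else 1)) *
                ((T.filter fun s => (g * ∏ q, (if ε q then x q else 1))⁻¹ * s ∈ H).card : ℤ) = 0).card +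
        (4 * d).totient *
          ((Finset.univ : Finset (Subgroup G)).filter fun H => ρ ∉ H ∧ H.index = 4 * d ∧ IsCyclic (G ⧸ H) ∧
            ∀ (g : G) (x : ↥d.primeFactors → G), (∀ q, x q ^ (q : ℕ) ∈ H) →
              ∑ ε : ↥d.primeFactors → Bool, (∏ q, (if ε q then (-1 : ℤ) else 1)) *
                ((T.filter fun s => (g * ∏ q, (if ε q then x q else 1))⁻¹ * s ∈ H).card : ℤ) = 0).card) := by
    rw [← Finset.sum_add_distrib]
    refine Finset.sum_congr rfl fun d hd => ?_
    rw [hfib₂D d (Finset.mem_of_mem_erase hd) (Finset.ne_of_mem_erase hd), hfib₄D d (Finset.mem_of_mem_erase hd) (Finset.ne_of_mem_erase hd)]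
  have htotal : ∑ H ∈ A, H.index.totient =
      ∑ H ∈ A.filter (fun H => ¬ 4 ∣ H.index), H.index.totient + ∑ H ∈ A.filter (fun H => 4 ∣ H.index), H.index.totient := by
    rw [add_comm, Finset.sum_filter_add_sum_filter_not]
  omega

/-- **NONDEGENERACY CRITERION IN EXPONENT `4m`, `m` ODD** (any finite commutative `G` with `g^{4m} = 1`, CM type `T`, involution `ρ`): `T` is NONDEGENERATE
(`rank = |G|/2 + 1`) iff NO index-`2` subgroup `H ∌ ρ` splits `T` evenly, NO index-`4` subgroup `H ∌ ρ` with cyclic quotient meets every coset in `|H|/2`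
elements of `T`, and for every divisor `d ≠ 1` of `m` NO subgroup `H ∌ ρ` of index `2d` with cyclic quotient, and NO subgroup `H ∌ ρ` of index `4d` with
cyclic quotient, has vanishing mixed differences of the coset counts along the prime torsion — every coefficient `φ(2d)`, `φ(4d)` of
`typeRank_add_card_kernels_eq_of_exponent_four_mul_odd` being positive. [cite: Kubota1965, §4 Lemma 2] [cite: Hazama2003CyclicCM, Prop. 4.3 and Thm. 4.8]
[cite: Dodson1984, §3.1.1 Theorem] [cite: Yanai2015IndexDegeneracy, Thm. 4.1] -/
theorem typeRank_eq_iff_of_exponent_four_mul_odd (hodd : ¬ 2 ∣ m)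
    (h : IsCMTypeWith ρ (T : Set G)) (hexp : ∀ g : G, g ^ (4 * m) = 1) :
    typeRank G (T : Set G) = Fintype.card G / 2 + 1 ↔
      (∀ H : Subgroup G, ρ ∉ H → H.index = 2 → (T.filter fun s => s ∈ H).card ≠ (T.filter fun s => s ∉ H).card) ∧
      (∀ H : Subgroup G, ρ ∉ H → H.index = 4 → IsCyclic (G ⧸ H) → ¬ ∀ g : G, 2 * ((T.filter fun s => g⁻¹ * s ∈ H).card) = Nat.card H) ∧
      (∀ d : ℕ, d ∣ m → d ≠ 1 → ∀ H : Subgroup G, ρ ∉ H → H.index = 2 * d → IsCyclic (G ⧸ H) →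
        ¬ ∀ (g : G) (x : ↥d.primeFactors → G), (∀ q, x q ^ (q : ℕ) ∈ H) →
          ∑ ε : ↥d.primeFactors → Bool, (∏ q, (if ε q then (-1 : ℤ) else 1)) *
            ((T.filter fun s => (g * ∏ q, (if ε q then x q else 1))⁻¹ * s ∈ H).card : ℤ) = 0) ∧
      (∀ d : ℕ, d ∣ m → d ≠ 1 → ∀ H : Subgroup G, ρ ∉ H → H.index = 4 * d → IsCyclic (G ⧸ H) →
        ¬ ∀ (g : G) (x : ↥d.primeFactors → G), (∀ q, x q ^ (q : ℕ) ∈ H) →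
          ∑ ε : ↥d.primeFactors → Bool, (∏ q, (if ε q then (-1 : ℤ) else 1)) *
            ((T.filter fun s => (g * ∏ q, (if ε q then x q else 1))⁻¹ * s ∈ H).card : ℤ) = 0) := by
  have key := typeRank_add_card_kernels_eq_of_exponent_four_mul_odd hodd h hexp
  have hm0 : m ≠ 0 := by
    rintro rfl
    exact hodd (dvd_zero 2)
  set b₂ := ((Finset.univ : Finset (Subgroup G)).filter fun H => ρ ∉ H ∧ H.index = 2 ∧
        (T.filter fun s => s ∈ H).card = (T.filter fun s => s ∉ H).card).card with hb₂
  set b₄ := ((Finset.univ : Finset (Subgroup G)).filter fun H : Subgroup G => ρ ∉ H ∧ H.index = 4 ∧ IsCyclic (G ⧸ H) ∧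
        ∀ g : G, 2 * ((T.filter fun s => g⁻¹ * s ∈ H).card) = Nat.card H).card with hb₄
  set c₂ : ℕ → ℕ := fun d =>
          ((Finset.univ : Finset (Subgroup G)).filter fun H => ρ ∉ H ∧ H.index = 2 * d ∧ IsCyclic (G ⧸ H) ∧
            ∀ (g : G) (x : ↥d.primeFactors → G), (∀ q, x q ^ (q : ℕ) ∈ H) →
              ∑ ε : ↥d.primeFactors → Bool, (∏ q, (if ε q then (-1 : ℤ) else 1)) *
                ((T.filter fun s => (g * ∏ q, (if ε q then x q else 1))⁻¹ * s ∈ H).card : ℤ) = 0).card with hc₂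
  set c₄ : ℕ → ℕ := fun d =>
          ((Finset.univ : Finset (Subgroup G)).filter fun H => ρ ∉ H ∧ H.index = 4 * d ∧ IsCyclic (G ⧸ H) ∧
            ∀ (g : G) (x : ↥d.primeFactors → G), (∀ q, x q ^ (q : ℕ) ∈ H) →
              ∑ ε : ↥d.primeFactors → Bool, (∏ q, (if ε q then (-1 : ℤ) else 1)) *
                ((T.filter fun s => (g * ∏ q, (if ε q then x q else 1))⁻¹ * s ∈ H).card : ℤ) = 0).card with hc₄
  have key' : typeRank G (T : Set G) + (b₂ + 2 * b₄ + ∑ d ∈ m.divisors.erase 1, ((2 * d).totient * c₂ d + (4 * d).totient * c₄ d)) =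
      Fintype.card G / 2 + 1 := by
    rw [← key]; ring
  have hiff : typeRank G (T : Set G) = Fintype.card G / 2 + 1 ↔
      b₂ = 0 ∧ b₄ = 0 ∧ ∀ d ∈ m.divisors.erase 1, (2 * d).totient * c₂ d + (4 * d).totient * c₄ d = 0 := by
    rw [← Finset.sum_eq_zero_iff]
    constructor
    · intro hr
      rw [hr] at key'
      refine ⟨by omega, by omega, by omega⟩
    · rintro ⟨h0, h1, h2⟩
      rw [h0, h1, h2, mul_zero, add_zero, add_zero, add_zero] at key'
      exact key'
  have hpos : ∀ d ∈ m.divisors, ∀ e : ℕ, 0 < e → 0 < (e * d).totient := fun d hd e he =>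
    Nat.totient_pos.2 (Nat.mul_pos he (Nat.pos_of_mem_divisors hd))
  have hterm : ∀ d ∈ m.divisors, ((2 * d).totient * c₂ d + (4 * d).totient * c₄ d = 0 ↔ c₂ d = 0 ∧ c₄ d = 0) := by
    intro d hd
    have h2 := hpos d hd 2 two_pos
    have h4 := hpos d hd 4 four_pos
    constructor
    · intro h0
      have h0' := Nat.eq_zero_of_add_eq_zero h0
      exact ⟨(Nat.mul_eq_zero.1 h0'.1).resolve_left h2.ne', (Nat.mul_eq_zero.1 h0'.2).resolve_left h4.ne'⟩
    · rintro ⟨h0, h1⟩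
      rw [h0, h1, mul_zero, mul_zero, add_zero]
  rw [hiff]
  -- read each vanishing as an emptiness statement
  have hb₂iff : b₂ = 0 ↔ ∀ H : Subgroup G, ρ ∉ H → H.index = 2 →
      (T.filter fun s => s ∈ H).card ≠ (T.filter fun s => s ∉ H).card := by
    rw [hb₂, Finset.card_eq_zero, Finset.filter_eq_empty_iff]
    constructor
    · intro hno H hρH hidx heq
      exact hno (Finset.mem_univ H) ⟨hρH, hidx, heq⟩
    · rintro hno H - ⟨hρH, hidx, heq⟩
      exact hno H hρH hidx heq
  have hb₄iff : b₄ = 0 ↔ ∀ H : Subgroup G, ρ ∉ H → H.index = 4 → IsCyclic (G ⧸ H) →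
      ¬ ∀ g : G, 2 * ((T.filter fun s => g⁻¹ * s ∈ H).card) = Nat.card H := by
    rw [hb₄, Finset.card_eq_zero, Finset.filter_eq_empty_iff]
    constructor
    · intro hno H hρH hidx hcyc hhalf
      exact hno (Finset.mem_univ H) ⟨hρH, hidx, hcyc, hhalf⟩
    · rintro hno H - ⟨hρH, hidx, hcyc, hhalf⟩
      exact hno H hρH hidx hcyc hhalf
  have hc₂iff : ∀ d, c₂ d = 0 ↔ ∀ H : Subgroup G, ρ ∉ H → H.index = 2 * d → IsCyclic (G ⧸ H) →
      ¬ ∀ (g : G) (x : ↥d.primeFactors → G), (∀ q, x q ^ (q : ℕ) ∈ H) →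
        ∑ ε : ↥d.primeFactors → Bool, (∏ q, (if ε q then (-1 : ℤ) else 1)) *
          ((T.filter fun s => (g * ∏ q, (if ε q then x q else 1))⁻¹ * s ∈ H).card : ℤ) = 0 := by
    intro d
    rw [hc₂]
    dsimp only
    rw [Finset.card_eq_zero, Finset.filter_eq_empty_iff]
    constructor
    · intro hno H hρH hidx hcyc hcrit
      exact hno (Finset.mem_univ H) ⟨hρH, hidx, hcyc, hcrit⟩
    · rintro hno H - ⟨hρH, hidx, hcyc, hcrit⟩
      exact hno H hρH hidx hcyc hcrit
  have hc₄iff : ∀ d, c₄ d = 0 ↔ ∀ H : Subgroup G, ρ ∉ H → H.index = 4 * d → IsCyclic (G ⧸ H) →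
      ¬ ∀ (g : G) (x : ↥d.primeFactors → G), (∀ q, x q ^ (q : ℕ) ∈ H) →
        ∑ ε : ↥d.primeFactors → Bool, (∏ q, (if ε q then (-1 : ℤ) else 1)) *
          ((T.filter fun s => (g * ∏ q, (if ε q then x q else 1))⁻¹ * s ∈ H).card : ℤ) = 0 := by
    intro d
    rw [hc₄]
    dsimp only
    rw [Finset.card_eq_zero, Finset.filter_eq_empty_iff]
    constructor
    · intro hno H hρH hidx hcyc hcrit
      exact hno (Finset.mem_univ H) ⟨hρH, hidx, hcyc, hcrit⟩
    · rintro hno H - ⟨hρH, hidx, hcyc, hcrit⟩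
      exact hno H hρH hidx hcyc hcrit
  rw [hb₂iff, hb₄iff]
  refine and_congr_right fun _ => and_congr_right fun _ => ?_
  constructor
  · intro hno
    refine ⟨fun d hd hd1 => ?_, fun d hd hd1 => ?_⟩
    · exact (hc₂iff d).1 ((hterm d (Nat.mem_divisors.2 ⟨hd, hm0⟩)).1 (hno d (Finset.mem_erase.2 ⟨hd1, Nat.mem_divisors.2 ⟨hd, hm0⟩⟩))).1
    · exact (hc₄iff d).1 ((hterm d (Nat.mem_divisors.2 ⟨hd, hm0⟩)).1 (hno d (Finset.mem_erase.2 ⟨hd1, Nat.mem_divisors.2 ⟨hd, hm0⟩⟩))).2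
  · rintro ⟨hno₂, hno₄⟩ d hd
    rw [Finset.mem_erase] at hd
    exact (hterm d hd.2).2 ⟨(hc₂iff d).2 (hno₂ d (Nat.dvd_of_mem_divisors hd.2) hd.1), (hc₄iff d).2 (hno₄ d (Nat.dvd_of_mem_divisors hd.2) hd.1)⟩

end ExponentFourOdd

end AbelianKernels

end CyclicCMType

end Literature.NumberTheory.ComplexMultiplication

end
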